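import Mathlib
import HarnessLib
import HarnessLib.Audit
import Summits.HubbardSuperconductivity.Statement
import Literature.MathematicalPhysics.QuantumLattice.HeisenbergModel
import HarnessLib.Audit.Status.Attr

/-!
Route: SpinOnePairBoson

DORMANT since 2026-08-22T23:28:39Z (reconciler: no traction for 5.7 d (last activity item-evidence-added at 2026-08-17T04:49:04Z); parked, not closed — `ledger route dormant route-HubbardSuperconductivity-SpinOnePairBoson --off` to reac) — unstaffed, not closed; items shared with open routes are served there. `ledger route dormant <id> --off` reactivates.

Route SpinOnePairBoson — HubbardSuperconductivity/HubbardSuperconductivity (plancard, card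
spin-one-escape-neves-perez; sibling of route PlaquetteBoson, which it does NOT duplicate: that
route's reflection-positivity input PbHalfFilledXYOrder is the OPEN S=1/2 near-Heisenberg problem at
Δ_eff ≈ −0.99; this route replaces the emergent object so that the input becomes a proved-class
theorem).

THESIS X (it suffices to show) = ANCHOR ∧ CONTINUATION, one-line Lean form `SopAnchorOrder ∧
SopContinuation` (both decls of this file elaborate, rc0 in the planner's Sketch.lean together with
a 3-line proof of the Assembly):
(ANCHOR, SopAnchorOrder) there are a cluster shape a×b (2/(ab) ∈ (0,1/2): 2×4 ↦ δ = 1/4, 4×4 ↦ δ =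
1/8), a symmetric intra-cluster nearest-neighbour hopping pattern τ (purely repulsive Hubbard class:
real n.n. hoppings + on-site U > 0, nothing else) and t₀ > 0 such that for every inter-cluster
hopping t' ∈ (0,t₀) every (N_L, S^z=0)-sector ground state of the cluster-modulated Hubbard torus
H_L(τ,t',U) (L large, 2a ∣ L, 2b ∣ L, N_L = 2⌊(1−2/(ab))L²/2⌋, i.e. exactly ONE HOLE PAIR PER
CLUSTER) has d_{x²−y²} pair-field order Re⟨ψ, Δ_d†Δ_d ψ⟩ ≥ c(t')·L⁴; and
(CONTINUATION, SopContinuation) at (U, δ = 2/(ab)) such small-t' order forces the summit's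
conclusion for the uniform model hubbardTorus 2 L 1 U = H_L(1,1,U) along all even sides.
Assembly (pure logic): SopAnchorOrder → SopContinuation → HubbardSuperconductivity.

MECHANISM behind the anchor (card spin-one-escape-neves-perez): at one hole pair per cluster and t'
→ 0 the low-energy manifold of each cluster is designed to be THREE consecutive even-charge ground
states |0⟩,|1⟩,|2⟩ (0, 1, 2 bound hole pairs) with a FLAT pair staircase E(4h)+E(0h) = 2E(2h), odd
charges gapped by the two pair bindings, every other charge strictly above the supporting line (crux
SopFlatClusterPoint). Second order in t' then gives an occupation-≤2 lattice boson = PSEUDOSPIN-1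
model on the (L/a)×(L/b) cluster torus with correlated hopping (h_A: lone pair, h_B: onto/off an
occupied cluster, h_C: pair next to pair), diagonal couplings v (S^zS^z), w ((S^z)²(S^z)²), a PH-odd
mixed term, and single-ion D. Reflection positivity of this model for bond-bisecting planes holds
exactly on the cone {PH symmetry: h_A = h_C, PH-odd diagonal = 0; h_B ≥ |h_A|; v ≥ 0; w ≤ 0} (D is a
free rider) — re-derived by the planner from the −Σ_k B_kΘ(B_k) form with B_k = α_k|0⟩⟨1| +
β_k|1⟩⟨2| and Θ = antilinear particle–hole-twisted reflection (the card missed w ≤ 0). On that cone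
the Dyson–Lieb–Simon/Kennedy–Lieb–Shastry machine closes in d = 2 for S = 1 on the WHOLE easy-plane
interval up to and including the Heisenberg point (Neves–Perez 1986; KLS 1988; Björnberg–Ueltschi
2022 Thm 3.2 with (3.9): margin 2.96 against ≤ 2 at S = 1, versus 1.11 at S = 1/2 which is why the S
= 1/2 plaquette boson is locked out) — and the two endpoints are PROVED IN THE TREE
(kennedy_lieb_shastry_ground_holds: d=2, S≥1 Néel; kennedy_lieb_shastry_xy_ground_holds: XY, all S).
Crux SopSpinOneOrder is the rider-stable, every-sector-ground-state version of that theorem for the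
5-parameter pseudospin-1 family; crux SopFlatClusterPoint is the typed half of the finite design
problem (certified ED of ≤ 16-site clusters); the coupling-admissibility half and the
Schrieffer–Wolff + DRESSING glue are the second layer under SopAnchorOrder.

TWO-LAYER PLAN (D-0019). Layer 1 = the four ranked cruxes below + Assembly. Layer 2 (filed at the
first split of SopAnchorOrder, once SopFlatClusterPoint has produced an actual cluster): (i) support
SopAdmissibleCouplings (informal now; typed when definition clusterPairBosonCouplings lands): the
O(t'²) two-cluster couplings at the flat point satisfy the PH equalities and
cone/stoquastic/easy-plane inequalities of SopSpinOneOrder's region; (ii) second-order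
Schrieffer–Wolff identity H_L(τ,t',U) ≅ t'²·H_S1(h,r,v,w,D) ⊕ gapped sectors + R, ‖R‖ = O(t'³) per
cluster; (iii) DRESSING LEMMA (shared in kind with PbAnchorOrder): the pseudospin-1 xy order
survives R and projects onto Δ_d with the nonzero cluster matrix elements of SopFlatClusterPoint;
(iv) anisotropic-superlattice corollary of SopSpinOneOrder if a ≠ b.
Ranked cruxes: 2 SopSpinOneOrder (the imported fact, provable now by the tree's own RP ⇒ GD ⇒ IR ⇒
sum-rule files; Literature-grade) · 3 SopFlatClusterPoint (cheapest kill: 2×4 ED in minutes, 4×4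
Lanczos in hours) · 4 SopAnchorOrder (the anchor theorem; contains the dressing lemma) · 5
SopContinuation (the bet). 5 items at open (+1 informal support, +1 definition request).

Rationale: WHY THIS LINE. Continuous-symmetry GROUND-STATE order in d = 2 is proved in exactly one way:
reflection positivity ⇒ Gaussian domination ⇒ infrared bound ⇒ T = 0 sum rule (DysonLiebSimon1978,
NevesPerez1986, KLS1988PRL, KLS1988JSP, KuboKishi1988; review BjornbergUeltschi2022). Its closure
inequality has a left side ∝ S(S+1) against an S-independent momentum integral: in d = 2 it holds on
the whole easy-plane-to-Heisenberg interval for every S ≥ 1 and fails for S = 1/2 except near XY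
(BjornbergUeltschi2022 Thm 3.2 + (3.9): (4/3)S(S+1)/(I Ĩ) = 2.96 > 2 at S = 1; = 1.11 at S = 1/2,
i.e. −J₂/J₁ ≤ 0.11, Kubo–Kishi 0.13). Cluster pair bosons of repulsive Hubbard blocks
(TsaiKivelson2006, YaoTsaiKivelson2007, TsaiEtAl2008) are S = 1/2 pseudospins locked to Δ_eff ≈ 1
(card plaquette-pseudospin-lockin; route PlaquetteBoson's open crux PbHalfFilledXYOrder at Δ ≈
−0.99). The card's move: keep the engine, CHANGE THE OBJECT — design the cluster so that its first
TWO pair additions form a flat three-state manifold, an emergent pseudospin-1, for which the engine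
closes at the isotropic point with 48% margin, and both endpoints of the needed theorem are already
PROVED IN THE TREE (kennedy_lieb_shastry_ground_holds d=2 S≥1;
kennedy_lieb_shastry_xy_ground_holds). Imported areas: RP/IR bounds for quantum spins (mathematical
physics), certified exact diagonalisation + interval/Miranda root certificates (certified
computation) for the design point, Schrieffer–Wolff operator identities. Catalogue: physical analogy
WITH explicit dictionary (cluster charge states ab, ab−2, ab−4 ↦ S^z = −1,0,+1; cluster pair
creation ↦ deformed S⁺ = √2(|1⟩⟨0| ± |2⟩⟨1|) channels; pair-field LRO ↦ S⁺_tot S⁻_tot ≥ cM⁴),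
posited-object-with-construction (the interface is the 5-parameter RP-admissible pseudospin-1 family
of SopSpinOneOrder; the construction is SopFlatClusterPoint + SopAdmissibleCouplings), certified
computation.
RANKED CRUXES. 2 SopSpinOneOrder — xy-LRO of every S^z_tot=0 ground state on large even tori for H =
Σ_⟨xy⟩[−h(S⁺S⁻+h.c.) − r(RR†+h.c.) + v S^zS^z + w (S^z)²(S^z)²] + DΣ(S^z)², R = −{S^z,S⁺}, on the
region {h>0, −ρh ≤ r ≤ 0, v ≥ 0, −ρh ≤ w ≤ 0, |D| ≤ ρh, v+2|w|+2|D| ≤ 2h} for some ρ > 0: the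
unproved-but-provable imported fact (r=w=D=0 is BjornbergUeltschi2022 Thm 3.2 in torus/sector form),
FIRST per plancard rule; Literature-grade and reusable. 3 SopFlatClusterPoint — typed half (A) of
the design: ∃ a×b cluster, symmetric n.n. pattern τ, U>0 with a flat pair staircase on {ab−4, ab−2,
ab}, every other charge strictly above the supporting line (⇒ both pair bindings and all charge
gaps), unique (hence singlet) sector ground states, nonzero d-wave pair matrix elements; cheapest
kill. 4 SopAnchorOrder — the anchor theorem (first repulsive n.n.-hopping Hubbard-class lattice
model with proved d-wave pair order if it lands); second layer = (B) coupling admissibility +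
Schrieffer–Wolff + DRESSING lemma (RP fragility: order of H_eff surviving the O(t'³) non-PH
remainder — open, shared in kind with PbAnchorOrder). 5 SopContinuation — (τ,t') → (1,1) at fixed
(U, δ = 2/(ab)); the bet, tool-less like every continuation.
KILL CRITERIA. (i) 2×4 (minutes) and D4-symmetric 4×4 / plaquette-of-plaquettes (hours) ED scans
over (U, hopping ratios): no point with flat staircase + bindings + unique singlet GSs, OR at every
flat point the O(t'²) couplings violate the cone (natural sign h_B < h_A: a lone pair hops more
easily than one next to a pair) or the easy-plane margin ⇒ close route as exhausted with the scan as
census (the lock-in then extends to S = 1: 'no small repulsive cluster realises an admissible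
pseudospin-1'); SopSpinOneOrder survives as a Literature target. (ii) SopSpinOneOrder refuted on
part of its region ⇒ restate on the surviving region if it still contains the design point, else
close. (iii) Numerics (DCA/CDMFT/DMRG t'-scan at the design (U,δ)) show a transition on the path ⇒
close; anchor items survive as Literature targets. (iv) A dressing-lemma no-go (RP order provably
destroyed by arbitrarily small non-RP PH-breaking perturbations in this class) kills this route AND
PlaquetteBoson's anchor.
NOT DECOMPOSED YET (deliberately). The Schrieffer–Wolff/dressing glue under SopAnchorOrder (needs
the actual cluster from crux 3 first); the typed form of (B) (definition request
clusterPairBosonCouplings filed); the anisotropic (a ≠ b) corollary of crux 2; the L ∤ 2a,2b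
residues at the uniform point (inside SopContinuation, where no cluster structure remains); any
mechanism for SopContinuation; negative-D (easy-axis single-ion) design points (excluded from crux
2's region on purpose: Ising/pair-density-wave side).
NOVELTY (full text in the Novelty field). Nearest prior art: BjornbergUeltschi2022 Thm 3.2 /
NevesPerez1986 / KLS1988JSP (the S ≥ 1, d = 2 ground-state closure — the engine), Lees2016 and
TanakaTanakaIdogaki2001 (RP/loop Néel order for S = 1 with biquadratic riders), TsaiEtAl2008 +
YaoTsaiKivelson2007 (cluster/hierarchical pair binding, S = 1/2 boson dictionaries), spin-1 ↔
occupation-≤2 boson dictionaries of cold-atom theory (doi:10.1103/physreva.70.043628). Delta: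
pseudospin SIZE as the escape from the S = 1/2 lock-in; the explicit RP-admissibility cone for
3-state correlated-hopping bosons (incl. w ≤ 0); the finite, certifiable design problem in a purely
repulsive n.n. Hubbard family; the rider-stable every-sector-GS S = 1 theorem typed over the tree's
spin objects. Card audited new-combination.
BARRIERS (full text in the Barriers field). StrongCouplingCeiling evaded (no t/U or cluster
expansion of the SU(2) model reaches the order; SW is a finite operator identity around gapped
designed clusters, order comes from RP/IR on the effective model; residue = dressing lemma,
admitted); WeakCouplingCeiling / PerturbativeInvisibilityOfPairing / GeneralizedHartreeFockNoPairing
not in class; LROForcesLowLyingStates respected (fixed-N sector LRO, towers harmless); T>0 barriers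
untouched; SignProblemNPHard irrelevant (≤16-site exhaustive ED; stoquastic effective model);
PureModelStripeCompetition = SopContinuation's why-might-fail (bites the 4×4, δ = 1/8 design
directly; the 2×4, δ = 1/4 design sits outside the transcribed box). Honest limit: RP remains the
only source of 2D ground-state continuous-symmetry order; the bet is that enlarging the emergent
spin moves the problem from an open infinite-volume inequality (S = 1/2, Δ ≈ 1) to a finite design
computation plus a rider-perturbation of a printed theorem.

Novelty: Searched this session (beyond the card's audited searches): `lit frontier HubbardSuperconductivity
--since 2020`, `lit bridges HubbardSuperconductivity --cross any` (no rigorous-SC or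
cluster-boson-RP entries); `lit search --hybrid "spin-1 bosons occupation two reflection positivity
Bose condensation long-range order ground state"` (cold-atom textbooks only); crossref "spin-1
bosons pair superfluid reflection positivity" (spin-1 Bose–Hubbard SF–MI papers, e.g.
doi:10.1103/physreva.70.043628, doi:10.1103/physrevb.86.045129 — no RP, no pair-of-pairs
construction); crossref "Neel order ground state spin one anisotropy infrared bounds reflection
positivity" → BjornbergUeltschi2022 (doi:10.4171/90-1/5 = arXiv:2204.12896, READ pp. 3, 8–11: Thm
3.2 ground-state LRO for n.n. couplings J³ = 1 ≥ J¹ ≥ −J² ≥ 0, all d ≥ 2 and all S except d = 2, S =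
1/2 where −J²/J¹ ≤ 0.109/0.13; condition (3.9) (4/3)S(S+1)/(I(d)Ĩ(d)), Table 1: I(2) = 1.393, Ĩ(2) =
0.6468); its refs Lees2016 (doi:10.1007/s00220-016-2656-1) and TanakaTanakaIdogaki2001
(doi:10.1088/0305-4470/34/42/304) = RP/random-loop Néel order for the S = 1 bilinear-biquadratic
model (riders of (S·S)² type); `lit vsearch` on RP + single-ion/biquadratic (Friedli–Velenik ch. 10,
Lieb selecta: generic); `lit galaxy search … --star all` (0 rows; galaxyd partly unavailable, rc
75); the tree: kennedy_lieb_shastry_ground_holds (HeisenbergOrderNeelHolds.lean, d = 2, S ≥ 1,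
sorry-free) and kennedy_lieb_shastry_xy_ground_holds (XYOrderGDProofs.lea  [refs: 10.1103/physreva.70.043628, 10.1103/physrevb.86.045129, 10.4171/90-1/5, 10.1007/s00220-016-2656-1, 10.1088/0305-4470/34/42/304, 2204.12896, doi:10.1103/physreva.70.043628, doi:10.1103/physrevb.86.045129, doi:10.4171/90-1/5, doi:10.1007/s00220-016-2656-1, doi:10.1088/0305-4470/34/42/304, BjornbergUeltschi2022, Lees2016, TanakaTanakaIdogaki2001, NevesPerez1986, TsaiKivelson2006, YaoTsaiKivelson2007,]

Barriers (technique_class: reflection-positivity; effective-boson; spin-one): - Literature.Barriers.HubbardSuperconductivity.StrongCouplingCeiling: evaded — no t/U,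
high-temperature, cluster or Pirogov–Sinai expansion of the SU(2) Hubbard model is asked to reach
the ordered phase; the only expansion is second-order Schrieffer–Wolff in t' around DECOUPLED
designed clusters whose three-state pair manifold is flat and gapped from every other charge sector
(SopFlatClusterPoint), delivering a finite operator identity H_L(τ,t',U) = t'²H_S1 ⊕ gapped + R; the
gapless xy order comes from reflection positivity + infrared bounds on the pseudospin-1 model
(SopSpinOneOrder). Residue: the dressing step inside SopAnchorOrder (admitted; it is that crux's
why-might-fail).
- Literature.Barriers.HubbardSuperconductivity.WeakCouplingCeiling: not in class — no expansion in
U, no Cooper logarithm; U = O(t) enters only through exact ≤16-site cluster spectra.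
- Literature.Barriers.HubbardSuperconductivity.PerturbativeInvisibilityOfPairing: not in class —
nothing is read off a power series in U; pairing is exact cluster pair binding (two bindings Δ₁, Δ₂
> 0 are hypotheses of the design point, certified by ED).
- Literature.Barriers.HubbardSuperconductivity.GeneralizedHartreeFockNoPairing: not in class — no
quasi-free or mean-field state anywhere; the anchor ground state is a dressed pseudospin-1
condensate.
- Literature.Barriers.HubbardSuperconductivity.LROForcesLowLyingStates: respected — every order
statement is ⟨Δ_d†Δ_d⟩- or ⟨S⁺_totS⁻_tot⟩-type LRO of fixed-charge sector gr

History (route lifecycle, newest last):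
- 2026-08-22T23:28:39Z · DORMANT — reconciler: no traction for 5.7 d (last activity item-evidence-added at 2026-08-17T04:49:04Z); parked, not closed — `ledger route dormant route-HubbardSupercond (operator:999:3526373)

sub-problem: HubbardSuperconductivity · status: dormant · opened planner-plancard-HubbardSuperconductivity-Hub-e46557eb-0 2026-08-15T11:02:42Z · rev 2 · ledger route-HubbardSuperconductivity-SpinOnePairBoson
GENERATED by the gate from the ledger (D-0016/17). Provers cite these decls: `theorem foo : Summit.HubbardSuperconductivity.HubbardSuperconductivity.Theses.SpinOnePairBoson.<Decl> := …` in Summits/HubbardSuperconductivity/HubbardSuperconductivity/Theorems/<Name>.lean.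
-/

namespace Summit.HubbardSuperconductivity.HubbardSuperconductivity.Theses.SpinOnePairBoson

open scoped BigOperators Topology Manifold Classical MeasureTheory ProbabilityTheory Matrix InnerProductSpace ComplexConjugate ContinuousMap
open Filter Set Function TopologicalSpace MeasureTheory

attribute [summit_statement] _root_.HubbardSuperconductivity

open Literature.Hubbard

/-- item stmt-HubbardSuperconductivity-2251 · crux · rank 2 · open · by planner
why it might fail: Printed/vendored only at r=w=D=0 and for the tracial GS functional (bjornbergUeltschi2022_ground_lro = B–U Thm 3.2; S=1,d=2 margin 2.96 vs 2). Item adds riders with r ABSENT from the margin (classical canting at v=2h, r=−ρh, any ρ>0) and every-S^z=0-sector GS (needs canonical RP + Perron–Frobenius).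
sources: BjornbergUeltschi2022, arXiv:2204.12896, Literature.MathematicalPhysics.QuantumLattice.bjornbergUeltschi2022_ground_lro, NevesPerez1986, KLS1988JSP, KLS1988PRL
[crux] PSEUDOSPIN-1 ORDER THEOREM (the imported fact; first crux per plancard rule). Dictionary:
cluster with k ∈ {0,1,2} hole pairs ↦ S^z = k − 1 (tree basis Fin 3: index 0 ↦ m = +1 ↦ 2 pairs);
pair creation channels ↦ S⁺ = √2(|1⟩⟨0| + |2⟩⟨1|) and R := −{S^z, S⁺} = √2(|1⟩⟨0| − |2⟩⟨1|)
(pair-number basis), so a PH-symmetric correlated pair hopping with amplitudes (h_A, h_B, h_C = h_A)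
is −h(S⁺_xS⁻_y + h.c.) − r(R_xR†_y + h.c.) with h_A = 2(h + r), h_B = 2(h − r); pair–pair repulsion
↦ v S^zS^z; biquadratic-density ↦ w (S^z)²(S^z)²; on-cluster curvature ↦ D (S^z)². CLAIM
(signature): ∃ ρ > 0 such that for all h > 0, r ∈ [−ρh, 0], v ≥ 0, w ∈ [−ρh, 0], |D| ≤ ρh with the
easy-plane margin v + 2|w| + 2|D| ≤ 2h, there are c > 0, M₀ with: for every even M ≥ M₀, every
normalised S^z_tot = 0-sector ground state ψ of H_M on the torus (ℤ/Mℤ)² has Re⟨ψ, S⁺_tot S⁻_tot ψ⟩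
≥ c·M⁴ (uniform xy order = pair condensate). STATUS: at r = w = D = 0 this is Björnberg–Ueltschi
2022 Thm 3.2 (arXiv:2204.12896 pp. 8–11; axes 3 := x, 1 := y, 2 := z, J³ = J¹ = 2h ≥ −J² = v ≥ 0 ⇔ 0
≤ v ≤ 2h; closure (3.9): (4/3)S(S+1)/(I(2)Ĩ(2)) = 2.96 > 1 + v/2h for S = 1, while S = 1/2 gives
1.11, i.e. Kubo–Kishi's window) fo -/
@[route_item "route-HubbardSuperconductivity-SpinOnePairBoson"]
def SopSpinOneOrder : Prop :=
  ∃ ρ : ℝ, 0 < ρ ∧ ∀ (h r v w D : ℝ), 0 < h → -(ρ * h) ≤ r → r ≤ 0 → 0 ≤ v → -(ρ * h) ≤ w → w ≤ 0 → |D| ≤ ρ * h → v + 2 * |w| + 2 * |D| ≤ 2 * h → ∃ c : ℝ, 0 < c ∧ ∃ M₀ : ℕ, ∀ (M : ℕ) [NeZero M], Even M → M₀ ≤ M → let H : Literature.MathematicalPhysics.QuantumLattice.Op (Literature.Probability.LatticeModels.TorusSite 2 M) 3 := (∑ x : Literature.Probability.LatticeModels.TorusSite 2 M, ∑ y : Literature.Probability.LatticeModels.TorusSite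 2 M, if (Literature.Probability.LatticeModels.torusGraph 2 M).Adj x y then ( -((h : ℂ) • (Literature.MathematicalPhysics.QuantumLattice.onSite x (Literature.MathematicalPhysics.QuantumLattice.spinRaise 2) * Literature.MathematicalPhysics.QuantumLattice.onSite y (Literature.MathematicalPhysics.QuantumLattice.spinLower 2))) - (r : ℂ) • (Literature.MathematicalPhysics.QuantumLattice.onSite x (Literature.MathematicalPhysics.QuantumLattice.SpinOperators.spinZ 2 * Literature.MathematicalPhysics.QuantumLattice.spinRaise 2 + Literature.MathematicalPhysics.QuantumLattice.spinRaise 2 * Literature.MathematicalPhysics.QuantumLattice.SpinOperators.spinZ 2) * Literature.MathematicalPhysics.QuantumLattice.onSite y (Matrix.conjTranspose (Literature.MathematicalPhysics.QuantumLattice.SpinOperators.spinZ 2 * Literature.MathematicalPhysics.QuantumLattice.spinRaise 2 + Literature.MathematicalPhysics.QuantumLattice.spinRaise 2 * Literature.MathematicalPhysics.QuantumLattice.SpinOperators.spinZ 2))) + ((v / 2 : ℝ) : ℂ) • (Literature.MathematicalPhysics.QuantumLattice.onSite x (Literature.MathematicalPhysics.QuantumLattice.SpinOperators.spinZ 2)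 * Literature.MathematicalPhysics.QuantumLattice.onSite y (Literature.MathematicalPhysics.QuantumLattice.SpinOperators.spinZ 2)) + ((w / 2 : ℝ) : ℂ) • (Literature.MathematicalPhysics.QuantumLattice.onSite x (Literature.MathematicalPhysics.QuantumLattice.SpinOperators.spinZ 2 * Literature.MathematicalPhysics.QuantumLattice.SpinOperators.spinZ 2) * Literature.MathematicalPhysics.QuantumLattice.onSite y (Literature.MathematicalPhysics.QuantumLattice.SpinOperators.spinZ 2 * Literature.MathematicalPhysics.QuantumLattice.SpinOperators.spinZ 2)) ) else 0) + (D : ℂ) • ∑ x : Literature.Probability.LatticeModels.TorusSite 2 M, Literature.MathematicalPhysics.QuantumLattice.onSite x (Literature.MathematicalPhysics.QuantumLattice.SpinOperators.spinZ 2 * Literature.MathematicalPhysics.QuantumLattice.SpinOperators.spinZ 2); ∀ (ψ : Literature.MathematicalPhysics.QuantumLattice.TensorIndex (Literature.Probability.LatticeModels.TorusSite 2 M) 3 → ℂ), ψ ∈ Literature.MathematicalPhysics.QuantumLattice.spinZSector (Λ := Literature.Probability.LatticeModels.TorusSite 2 M) 2 0 → star ψ ⬝ᵥ ψ = 1 →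 Matrix.mulVec H ψ = ((Literature.MathematicalPhysics.QuantumLattice.lowestEnergyInSector 2 H 0 : ℝ) : ℂ) • ψ → c * (M : ℝ) ^ 4 ≤ (star ψ ⬝ᵥ Matrix.mulVec ((∑ x : Literature.Probability.LatticeModels.TorusSite 2 M, Literature.MathematicalPhysics.QuantumLattice.onSite x (Literature.MathematicalPhysics.QuantumLattice.spinRaise 2)) * (∑ y : Literature.Probability.LatticeModels.TorusSite 2 M, Literature.MathematicalPhysics.QuantumLattice.onSite y (Literature.MathematicalPhysics.QuantumLattice.spinLower 2))) ψ).re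

/-- item stmt-HubbardSuperconductivity-2252 · crux · rank 3 · open · by planner
why it might fail: Needs an exact transversal zero of the on-cluster pair–pair interaction κ=E(ab−4)+E(ab)−2E(ab−2) with both pair bindings, strict supporting line, unique singlet GSs, nonzero d-wave elements; TsaiEtAl2008 p.3 Eq.(3): 'we never find a negative value of κ_N' (16 sites) — κ>0 may persist for all a×b,τ,U
sources: TsaiEtAl2008, arXiv:0803.0933, TsaiKivelson2006, YaoTsaiKivelson2007, idea:HubbardSuperconductivity/HubbardSuperconductivity/spin-one-escape-neves-perez, idea:HubbardSuperconductivity/HubbardSuperconductivity/plaquette-pseudospin-lockin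
[crux] DESIGN POINT, typed half (A): the isolated cluster. There exist a cluster a×b (2/(ab) ∈
(0,1/2), ab even; intended 2×4 ↦ δ = 1/4 and D4-symmetric 4×4 'plaquette of plaquettes' ↦ δ = 1/8),
a symmetric real nearest-neighbour hopping pattern τ on it and U > 0 such that, for H_C = −Σ_{p~q,σ}
τ(p,q) c†_{pσ}c_{qσ} + U Σ n↑n↓ on Fock(Orb(Fin a ×ₗ Fin b)) with E(N) := groundEnergy H_C N: (i)
FLAT PAIR STAIRCASE with strict supporting line: ∃ μ, E(N) = E(ab−2) + μ(N − ab + 2) for N ∈ {ab,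
ab−2, ab−4} and E(N) > that line for every other N ≤ 2ab — equivalently on-cluster pair–pair
interaction E(ab−4) + E(ab) − 2E(ab−2) = 0, both pair bindings 2E(ab−1) > E(ab)+E(ab−2), 2E(ab−3) >
E(ab−2)+E(ab−4) and all charge-transfer gaps positive, i.e. at one pair per cluster the decoupled
lattice has exactly the product manifold {0,1,2 pairs}^clusters as ground manifold; (ii) the ground
state in each of the three charge sectors is unique up to phase over ALL S^z (hence a singlet);
(iii) nonzero d_{x²−y²} pair matrix elements ⟨φ_{k+1}, Δ_d^C φ_k⟩ ≠ 0, k = 0,1 (Δ_d^C = Σ over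
cluster n.n. bonds, +1 horizontal / −1 vertical, of c_{p↑}c_{q↓}). Knobs: U and the bond-class
ratios of τ (2×4 with D2: 4 cla -/
@[route_item "route-HubbardSuperconductivity-SpinOnePairBoson"]
def SopFlatClusterPoint : Prop :=
  ∃ (a b : ℕ) (τ : ℕ × ℕ → ℕ × ℕ → ℝ) (U μ : ℝ), 0 < U ∧ Even (a * b) ∧ (2 : ℝ) / ((a : ℝ) * (b : ℝ)) ∈ Set.Ioo (0:ℝ) (1 / 2) ∧ (∀ p q, τ p q = τ q p) ∧ let H : Matrix (Finset (Literature.MathematicalPhysics.QuantumLattice.Orb (Lex (Fin a × Fin b)))) (Finset (Literature.MathematicalPhysics.QuantumLattice.Orb (Lex (Fin a × Fin b)))) ℂ := (-(∑ p : Lex (Fin a × Fin b), ∑ q : Lex (Fin a × Fin b), ∑ σ : Fin 2, ((if ((ofLex p).1 = (ofLex q).1 ∧ (((ofLex p).2 : ℕ) + 1 = (ofLex q).2 ∨ ((ofLex q).2 : ℕ) + 1 = (ofLex p).2)) ∨ ((ofLex p).2 = (ofLex q).2 ∧ (((ofLex p).1 : ℕ) + 1 = (ofLex q).1 ∨ ((ofLex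 q).1 : ℕ) + 1 = (ofLex p).1)) then τ (((ofLex p).1 : ℕ), ((ofLex p).2 : ℕ)) (((ofLex q).1 : ℕ), ((ofLex q).2 : ℕ)) else 0 : ℝ) : ℂ) • (Literature.MathematicalPhysics.QuantumLattice.creation (Literature.MathematicalPhysics.QuantumLattice.orb p σ) * Literature.MathematicalPhysics.QuantumLattice.annihilation (Literature.MathematicalPhysics.QuantumLattice.orb q σ))) + (U : ℂ) • ∑ p : Lex (Fin a × Fin b), Literature.MathematicalPhysics.QuantumLattice.numberOp p 0 * Literature.MathematicalPhysics.QuantumLattice.numberOp p 1); let Δ : Matrix (Finset (Literature.MathematicalPhysics.QuantumLattice.Orb (Lex (Fin a × Fin b)))) (Finset (Literature.MathematicalPhysics.QuantumLattice.Orb (Lex (Fin a × Fin b)))) ℂ := (∑ p : Lex (Fin a × Fin b), ∑ q : Lex (Fin a × Fin b), ((if (ofLex p).1 = (ofLex q).1 ∧ (((ofLex p).2 : ℕ) + 1 = (ofLex q).2 ∨ ((ofLex q).2 : ℕ) + 1 = (ofLex p).2) then (1 : ℝ) else if (ofLex p).2 = (ofLex q).2 ∧ (((ofLex p).1 : ℕ)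 + 1 = (ofLex q).1 ∨ ((ofLex q).1 : ℕ) + 1 = (ofLex p).1) then (-1 : ℝ) else 0 : ℝ) : ℂ) • (Literature.MathematicalPhysics.QuantumLattice.annihilation (Literature.MathematicalPhysics.QuantumLattice.orb p 0) * Literature.MathematicalPhysics.QuantumLattice.annihilation (Literature.MathematicalPhysics.QuantumLattice.orb q 1))); (∀ N : ℕ, N ≤ 2 * (a * b) → ((N = a * b ∨ N = a * b - 2 ∨ N = a * b - 4) → Literature.MathematicalPhysics.QuantumLattice.groundEnergy H N = Literature.MathematicalPhysics.QuantumLattice.groundEnergy H (a * b - 2) + μ * ((N : ℝ) - ((a * b - 2 : ℕ) : ℝ))) ∧ (N ≠ a * b → N ≠ a * b - 2 → N ≠ a * b - 4 → Literature.MathematicalPhysics.QuantumLattice.groundEnergy H (a * b - 2) + μ * ((N : ℝ) - ((a * b - 2 : ℕ) : ℝ)) < Literature.MathematicalPhysics.QuantumLattice.groundEnergy H N)) ∧ (∀ N : ℕ, (N = a * b ∨ N = a * b - 2 ∨ N = a * b - 4) → ∀ φ φ' : Literature.MathematicalPhysics.QuantumLattice.Fock (Literature.MathematicalPhysics.QuantumLattice.Orb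 (Lex (Fin a × Fin b))), Literature.MathematicalPhysics.QuantumLattice.IsGroundState H N φ → Literature.MathematicalPhysics.QuantumLattice.IsGroundState H N φ' → ∃ z : ℂ, φ' = z • φ) ∧ (∀ φ₀ φ₁ φ₂ : Literature.MathematicalPhysics.QuantumLattice.Fock (Literature.MathematicalPhysics.QuantumLattice.Orb (Lex (Fin a × Fin b))), Literature.MathematicalPhysics.QuantumLattice.IsGroundState H (a * b) φ₀ → Literature.MathematicalPhysics.QuantumLattice.IsGroundState H (a * b - 2) φ₁ → Literature.MathematicalPhysics.QuantumLattice.IsGroundState H (a * b - 4) φ₂ → star φ₁ ⬝ᵥ Matrix.mulVec Δ φ₀ ≠ 0 ∧ star φ₂ ⬝ᵥ Matrix.mulVec Δ φ₁ ≠ 0)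

/-- item stmt-HubbardSuperconductivity-2253 · crux · rank 4 · open · by planner
why it might fail: Needs (A) SopFlatClusterPoint, (B) admissible O(t'²) couplings (h_A=h_C, PH-odd diagonal=0, h_B≥h_A against the natural h_B<h_A) AND the dressing lemma: U(1) RP/IR order of t'²H_S1 surviving an extensive O(t'³) non-RP remainder in EVERY GS of a possibly degenerate Hubbard sector — no tool exists.
sources: idea:HubbardSuperconductivity/HubbardSuperconductivity/spin-one-escape-neves-perez, idea:HubbardSuperconductivity/HubbardSuperconductivity/plaquette-boson-kls-anchor, stmt-HubbardSuperconductivity-0905, YaoTsaiKivelson2007, TsaiEtAl2008, KLS1988JSP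
[crux] ANCHOR THEOREM. H_L(τ,t',U) := −Σ_{x~y,σ} W(x,y) c†_{xσ}c_{yσ} + U Σ_x n_{x↑}n_{x↓} on
Fock((ℤ/Lℤ)²) with W = τ(local coords) on bonds inside an a×b cluster {⌊x₀/a⌋,⌊x₁/b⌋ fixed} and W =
t' on bonds between clusters (signature: explicit creation/annihilation sum over fermionTorusGraph 2
L; W(·,·) symmetric because τ is); H_L(1,1,U) = hubbardTorus 2 L 1 U propositionally. CLAIM: ∃ a b τ
U (U > 0, 2/(ab) ∈ (0,1/2), τ symmetric) ∃ t₀ > 0 ∀ t' ∈ (0,t₀) ∃ c > 0: for all large L with 2a ∣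
L, 2b ∣ L (even cluster-torus sides, needed by RP) every normalised (N_L, S^z=0)-sector GS of
H_L(τ,t',U), N_L = 2⌊(1 − 2/(ab))L²/2⌋ (= exactly one hole pair per cluster), has Re⟨ψ, Δ_d†Δ_d ψ⟩ ≥
c·L⁴ with the summit's own Δ_d = pairField dWaveFormFactor L. INTENDED SECOND LAYER (glue, filed at
the first split, after SopFlatClusterPoint names the cluster): (i) SopFlatClusterPoint (A) +
SopAdmissibleCouplings (B) at (a,b,τ,U); (ii) second-order Schrieffer–Wolff: with P = product of the
clusters' three-state manifolds (flat and gapped by (A)), H_L = E₀ + t'²·[H_S1(h,r,v,w,D_eff) on the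
(L/a)×(L/b) cluster torus, in the dictionary of SopSpinOneOrder, anisotropic if a ≠ b] ⊕ (gapped
complement) + R, ‖ -/
@[route_item "route-HubbardSuperconductivity-SpinOnePairBoson", crux]
def SopAnchorOrder : Prop :=
  ∃ (a b : ℕ) (τ : ℕ × ℕ → ℕ × ℕ → ℝ) (U : ℝ), 0 < U ∧ (2 : ℝ) / ((a : ℝ) * (b : ℝ)) ∈ Set.Ioo (0:ℝ) (1 / 2) ∧ (∀ p q, τ p q = τ q p) ∧ ∃ t₀ : ℝ, 0 < t₀ ∧ ∀ t' ∈ Set.Ioo (0:ℝ) t₀, ∃ c : ℝ, 0 < c ∧ ∃ L₀ : ℕ, ∀ (L : ℕ) [NeZero L], L₀ ≤ L → 2 * a ∣ L → 2 * b ∣ L → ∀ (N : ℕ) (ψ : Literature.MathematicalPhysics.QuantumLattice.Fock (Literature.MathematicalPhysics.QuantumLattice.Orb (Literature.MathematicalPhysics.QuantumLattice.FermionTorus 2 L))), N = 2 * ⌊(1 - (2 : ℝ) / ((a : ℝ) * (b : ℝ))) * (L : ℝ) ^ 2 / 2⌋₊ → star ψ ⬝ᵥ ψ = 1 → Literature.MathematicalPhysics.QuantumLattice.IsGroundStateInSector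 (-(∑ x : Literature.MathematicalPhysics.QuantumLattice.FermionTorus 2 L, ∑ y : Literature.MathematicalPhysics.QuantumLattice.FermionTorus 2 L, ∑ σ : Fin 2, (((if (Literature.MathematicalPhysics.QuantumLattice.fermionTorusGraph 2 L).Adj x y then (if ((ofLex x) 0 : ℕ) / a = ((ofLex y) 0 : ℕ) / a ∧ ((ofLex x) 1 : ℕ) / b = ((ofLex y) 1 : ℕ) / b then τ (((ofLex x) 0 : ℕ) % a, ((ofLex x) 1 : ℕ) % b) (((ofLex y) 0 : ℕ) % a, ((ofLex y) 1 : ℕ) % b) else t') else 0 : ℝ)) : ℂ) • (Literature.MathematicalPhysics.QuantumLattice.creation (Literature.MathematicalPhysics.QuantumLattice.orb x σ) * Literature.MathematicalPhysics.QuantumLattice.annihilation (Literature.MathematicalPhysics.QuantumLattice.orb y σ))) + (U : ℂ) • ∑ x : Literature.MathematicalPhysics.QuantumLattice.FermionTorus 2 L, Literature.MathematicalPhysics.QuantumLattice.numberOp x 0 * Literature.MathematicalPhysics.QuantumLattice.numberOp x 1) N 0 ψ → c * (L : ℝ) ^ 4 ≤ (Literature.MathematicalPhysics.QuantumLattice.expect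 (Matrix.conjTranspose (Literature.MathematicalPhysics.QuantumLattice.pairField Literature.MathematicalPhysics.QuantumLattice.dWaveFormFactor L) * Literature.MathematicalPhysics.QuantumLattice.pairField Literature.MathematicalPhysics.QuantumLattice.dWaveFormFactor L) ψ).re

/-- item stmt-HubbardSuperconductivity-2254 · crux · rank 5 · open · by planner
why it might fail: Stated ∀(a,b,τ,U): ONE modulated family that orders at small t' at a (U, δ=2/(ab)) where the uniform model lacks d-wave LRO falsifies it — 4×4 designs end at δ=1/8, U≈8 inside PureModelStripeCompetition (QinEtAl2020, XuEtAl2024); 2×4 ends at δ=1/4 (unsettled); gapless phase, no continuation tool.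
sources: QinEtAl2020, XuEtAl2024, DoluweeraEtAl2008, ChakrabortySenechalTremblay2011, TsaiKivelson2006, TsaiEtAl2008
[crux] CONTINUATION (τ, t') → (1, 1) (the bet; typed as an implication so that the Assembly is pure
logic — same shape as PbContinuation of route PlaquetteBoson but for the cluster-modulated family at
δ = 2/(ab)): for all a, b, symmetric τ, U > 0 with 2/(ab) ∈ (0,1/2): [anchor-type every-GS d-wave
order Re⟨Δ_d†Δ_d⟩ ≥ c(t')L⁴ on the 2a∣L, 2b∣L tori of H_L(τ,t',U) for all t' ∈ (0,t₀)] ⇒ [the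
summit's conclusion at (U, δ = 2/(ab)): every HYP-admissible ground-state sequence of hubbardTorus 2
L 1 U has HasLongRangeOrder of torusPullback (pairFieldCorr dWaveFormFactor ψ) along even sides].
Content: (1) no quantum phase transition along a path (τ(s), t'(s)) from (τ*, small t') to (1, 1) at
fixed (U, δ) — physically the adiabatic continuity of the modulated d-wave superconductor to the
uniform one (TsaiKivelson2006 conjecture; DCA: d-SC continuous in t', suppressed by inhomogeneity,
maximal at t' = 1, DoluweeraEtAl2008; CDMFT agrees, ChakrabortySenechalTremblay2011; 'optimal
inhomogeneity' at intermediate t' in small clusters, TsaiEtAl2008); (2) removal of the 2a∣L, 2b∣L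
artefact at the uniform point (no cluster structure remains; comparison of even L) and the
pointwise-to-liminf bookkeep -/
@[route_item "route-HubbardSuperconductivity-SpinOnePairBoson", crux]
def SopContinuation : Prop :=
  ∀ (a b : ℕ) (τ : ℕ × ℕ → ℕ × ℕ → ℝ) (U : ℝ), 0 < U → (2 : ℝ) / ((a : ℝ) * (b : ℝ)) ∈ Set.Ioo (0:ℝ) (1 / 2) → (∀ p q, τ p q = τ q p) → (∃ t₀ : ℝ, 0 < t₀ ∧ ∀ t' ∈ Set.Ioo (0:ℝ) t₀, ∃ c : ℝ, 0 < c ∧ ∃ L₀ : ℕ, ∀ (L : ℕ) [NeZero L], L₀ ≤ L → 2 * a ∣ L → 2 * b ∣ L → ∀ (N : ℕ) (ψ : Literature.MathematicalPhysics.QuantumLattice.Fock (Literature.MathematicalPhysics.QuantumLattice.Orb (Literature.MathematicalPhysics.QuantumLattice.FermionTorus 2 L))), N = 2 * ⌊(1 - (2 : ℝ) / ((a : ℝ) * (b : ℝ))) * (L : ℝ) ^ 2 / 2⌋₊ → star ψ ⬝ᵥ ψ = 1 → Literature.MathematicalPhysics.QuantumLattice.IsGroundStateInSector (-(∑ x :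 Literature.MathematicalPhysics.QuantumLattice.FermionTorus 2 L, ∑ y : Literature.MathematicalPhysics.QuantumLattice.FermionTorus 2 L, ∑ σ : Fin 2, (((if (Literature.MathematicalPhysics.QuantumLattice.fermionTorusGraph 2 L).Adj x y then (if ((ofLex x) 0 : ℕ) / a = ((ofLex y) 0 : ℕ) / a ∧ ((ofLex x) 1 : ℕ) / b = ((ofLex y) 1 : ℕ) / b then τ (((ofLex x) 0 : ℕ) % a, ((ofLex x) 1 : ℕ) % b) (((ofLex y) 0 : ℕ) % a, ((ofLex y) 1 : ℕ) % b) else t') else 0 : ℝ)) : ℂ) • (Literature.MathematicalPhysics.QuantumLattice.creation (Literature.MathematicalPhysics.QuantumLattice.orb x σ) * Literature.MathematicalPhysics.QuantumLattice.annihilation (Literature.MathematicalPhysics.QuantumLattice.orb y σ))) + (U : ℂ) • ∑ x : Literature.MathematicalPhysics.QuantumLattice.FermionTorus 2 L, Literature.MathematicalPhysics.QuantumLattice.numberOp x 0 * Literature.MathematicalPhysics.QuantumLattice.numberOp x 1) N 0 ψ → c * (L : ℝ) ^ 4 ≤ (Literature.MathematicalPhysics.QuantumLattice.expect (Matrix.conjTranspose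 (Literature.MathematicalPhysics.QuantumLattice.pairField Literature.MathematicalPhysics.QuantumLattice.dWaveFormFactor L) * Literature.MathematicalPhysics.QuantumLattice.pairField Literature.MathematicalPhysics.QuantumLattice.dWaveFormFactor L) ψ).re) → ∀ (N : ℕ → ℕ) (ψ : ∀ L, Literature.MathematicalPhysics.QuantumLattice.Fock (Literature.MathematicalPhysics.QuantumLattice.Orb (Literature.MathematicalPhysics.QuantumLattice.FermionTorus 2 L))), (∀ L, Even L → N L = 2 * ⌊(1 - (2 : ℝ) / ((a : ℝ) * (b : ℝ))) * (L : ℝ) ^ 2 / 2⌋₊ ∧ star (ψ L) ⬝ᵥ ψ L = 1 ∧ Literature.MathematicalPhysics.QuantumLattice.IsGroundStateInSector (Literature.MathematicalPhysics.QuantumLattice.hubbardTorus 2 L 1 U) (N L) 0 (ψ L)) → Literature.Probability.LatticeModels.HasLongRangeOrder (fun k => Literature.Probability.LatticeModels.halfOpenBox 2 (2 * k)) (fun k => Literature.MathematicalPhysics.QuantumLattice.torusPullback (Literature.MathematicalPhysics.QuantumLattice.pairFieldCorr Literature.MathematicalPhysics.QuantumLattice.dWaveFormFactor ψ) (2 *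 k))

-- item stmt-HubbardSuperconductivity-2429 · support · rank 9 · open · by planner — informal only, no Lean statement yet:
--   [support] DESIGN POINT, untyped half (B): ADMISSIBLE COUPLINGS (typed once definition
--   clusterPairBosonCouplings lands; second layer under SopAnchorOrder). At a point (a, b, τ, U) of
--   SopFlatClusterPoint let |k⟩ (k = 0,1,2 hole pairs) be the three flat cluster ground states and V =
--   −t' Σ_{inter-cluster bonds ⟨p,q⟩, σ} (c†_{pσ}c_{qσ} + h.c.). The O(t'²) two-cluster effective
--   Hamiltonian P V (E₀ − H₀)⁻¹ V P on the product manifold (no three-cluster terms at this order) is,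
--   per superlattice bond direction, a pseudospin-1 bond operator with: correlated pair hopping
--   amplitudes h_A [(0,1)→(1,0)], h_B

/-- item stmt-HubbardSuperconductivity-2255 · assembly · rank 1 · closed · proved by Summit.HubbardSuperconductivity.HubbardSuperconductivity.Theorems.spinOnePairBoson_assembly_proof (prover) · by planner
sources: Scalapino1995, idea:HubbardSuperconductivity/HubbardSuperconductivity/spin-one-escape-neves-perez
[assembly] Pure logic (planner's Sketch.lean, rc0): `intro hA hC; obtain ⟨a, b, τ, U, hU, hδ, hτ,
hrest⟩ := hA; exact ⟨U, hU, _, hδ, fun N ψ hyp => hC a b τ U hU hδ hτ hrest N ψ hyp⟩` — instantiates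
the summit's (U, δ) with (U, 2/(ab)). SopSpinOneOrder and SopFlatClusterPoint are the pre-filed
second layer under SopAnchorOrder (glue = SopAdmissibleCouplings + Schrieffer–Wolff + dressing,
filed at the first split). -/
@[route_item "route-HubbardSuperconductivity-SpinOnePairBoson"]
def Assembly : Prop :=
  SopAnchorOrder → SopContinuation → HubbardSuperconductivity

/-! D-0027 §2.1 — DECIDING THEOREM (planner-authored via `route open/edit --closes-file`; by planner-rbadge-HubbardSuperconductivity-SpinOn-3b93e0a6-g2-0 2026-08-15T16:15:03Z):
its hypotheses are this route's items and its conclusion the sub-problem Statement (glue_lint), and it elaborates with this file. -/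

@[closes "route-HubbardSuperconductivity-SpinOnePairBoson"] theorem closes (hA : SopAnchorOrder) (hC : SopContinuation) :
    _root_.HubbardSuperconductivity := by
  obtain ⟨a, b, τ, U, hU, hδ, hτ, hrest⟩ := hA
  exact ⟨U, hU, _, hδ, fun N ψ hyp => hC a b τ U hU hδ hτ hrest N ψ hyp⟩

end Summit.HubbardSuperconductivity.HubbardSuperconductivity.Theses.SpinOnePairBoson
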